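import Summits.AtomisticToContinuum.FouriersLaw.Theorems.JunctionLocalityNonBallisticOfZeroDrudeWeight
import Summits.AtomisticToContinuum.FouriersLaw.Theses.JunctionLocality
import Summits.AtomisticToContinuum.FouriersLaw.Theses.BondHeatUncertainty
import Summits.AtomisticToContinuum.FouriersLaw.Theses.CurrentTiltQuench

/-! Glue-by probe (strategist s2): the LANDED theorem
`Summit.AtomisticToContinuum.FouriersLaw.Theorems.NonBallistic.nonBallistic_of_extensiveSnapshotIrreversibility_of_currentTiltQuench` (p150755)
has, BY TERM, the type Child1 → Child2 → Child3 → JunctionLocality.NonBallistic with the three child TEXTS spelled verbatim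
(ledger signatures of stmt-9121 / 11032 / 11030), and each child is `Iff.rfl`-equal to the named decl it dedups onto. -/

namespace Summit.AtomisticToContinuum.FouriersLaw.Theses.JunctionLocality.SplitGlueProbe

/-- child 1 = stmt-AtomisticToContinuum-9121 verbatim -/
def Child1 : Prop := ∀ ω₂ lam β γ : ℝ, 0 < ω₂ → 0 < lam → 0 < β → 0 < γ → (∀ (N : ℕ) (T_L T_R : ℝ), 0 < T_L → 0 < T_R → ∀ μ ν : MeasureTheory.Measure (Literature.MathematicalPhysics.KineticTheory.HeatConduction.PhaseSpace N), (Literature.MathematicalPhysics.KineticTheory.HeatConduction.pinnedChain ω₂ lam β γ).IsSteadyState N T_L T_R μ → (Literature.MathematicalPhysics.KineticTheory.HeatConduction.pinnedChain ω₂ lam β γ).IsSteadyState N T_L T_R ν → μ = ν) → ∀ μ : (N : ℕ) → ℝ → ℝ → MeasureTheory.Measure (Literature.MathematicalPhysics.KineticTheory.HeatConduction.PhaseSpace N), (∀ (N : ℕ) (T_L T_R : ℝ), 0 < T_L → 0 < T_R → (Literature.MathematicalPhysics.KineticTheory.HeatConduction.pinnedChain ω₂ lam β γ).IsSteadyState N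 T_L T_R (μ N T_L T_R)) → ∀ T : ℝ, 0 < T → ∃ C : ℝ, ∀ N : ℕ, ∀ᶠ δ in nhdsWithin (0 : ℝ) {(0 : ℝ)}ᶜ, InformationTheory.klDiv (μ N (T + δ / 2) (T - δ / 2)) (MeasureTheory.Measure.map (fun x : Literature.MathematicalPhysics.KineticTheory.HeatConduction.PhaseSpace N => (x.1, -x.2)) (μ N (T + δ / 2) (T - δ / 2))) ≤ ENNReal.ofReal (C * (N : ℝ) * δ ^ 2)

/-- child 2 = stmt-AtomisticToContinuum-11032 verbatim -/
def Child2 : Prop := ∀ ω₂ lam β γ : ℝ, 0 < ω₂ → 0 < lam → 0 < β → ∀ T : ℝ, 0 < T → ∀ μ : MeasureTheory.Measure Literature.MathematicalPhysics.KineticTheory.HeatConduction.ChainConfig, (Literature.MathematicalPhysics.KineticTheory.HeatConduction.pinnedChain ω₂ lam β γ).IsChainGibbsMeasure T μ → Literature.MathematicalPhysics.KineticTheory.HeatConduction.IsShiftInvariant μ → μ.map (fun σ : Literature.MathematicalPhysics.KineticTheory.HeatConduction.ChainConfig => fun x : ℤ => ((σ x).1, -(σ x).2)) = μ → ∀ D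 : Literature.MathematicalPhysics.KineticTheory.HeatConduction.InfiniteChainDynamics (Literature.MathematicalPhysics.KineticTheory.HeatConduction.pinnedChain ω₂ lam β γ), D.PreservesMeasure μ → (∀ t : ℝ, ∀ᵐ σ ∂μ, D.flow t (Literature.MathematicalPhysics.KineticTheory.HeatConduction.shift σ) = Literature.MathematicalPhysics.KineticTheory.HeatConduction.shift (D.flow t σ)) → (∀ t : ℝ, D.HasAbsConvergentCorrelation μ t) → (∀ M : ℝ, 0 < M → ∀ F : ℝ → ℝ, F = (fun u : ℝ => max (-M) (min M u)) → ∀ η : ℝ, 0 < η → ∃ τ₀ : ℝ, ∀ τ : ℝ, τ₀ ≤ τ → ∃ L₀ : ℕ, ∀ L : ℕ, L₀ ≤ L → ∀ G : Literature.MathematicalPhysics.KineticTheory.HeatConduction.ChainConfig → ℝ, G = (fun σ : Literature.MathematicalPhysics.KineticTheory.HeatConduction.ChainConfig => ∑ x ∈ Finset.Icc (-(L : ℤ)) (L : ℤ), F ((Literature.MathematicalPhysics.KineticTheory.HeatConduction.pinnedChain ω₂ lam β γ).bondCurrentZ σ x)) → |(τ⁻¹ * ∫ t in (0:ℝ)..τ,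 ((∫ σ, F ((Literature.MathematicalPhysics.KineticTheory.HeatConduction.pinnedChain ω₂ lam β γ).bondCurrentZ (D.flow t σ) 0) * G σ ∂μ) - (∫ σ, F ((Literature.MathematicalPhysics.KineticTheory.HeatConduction.pinnedChain ω₂ lam β γ).bondCurrentZ (D.flow t σ) 0) ∂μ) * (∫ σ, G σ ∂μ)))| ≤ η) → Filter.Tendsto (fun τ : ℝ => τ⁻¹ * ∫ t in (0:ℝ)..τ, D.currentCorrelation μ t) Filter.atTop (nhds 0)

/-- child 3 = stmt-AtomisticToContinuum-11030 verbatim -/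
def Child3 : Prop := ∀ ω₂ lam β γ : ℝ, 0 < ω₂ → 0 < lam → 0 < β → ∀ T : ℝ, 0 < T → ∀ μ : MeasureTheory.Measure Literature.MathematicalPhysics.KineticTheory.HeatConduction.ChainConfig, (Literature.MathematicalPhysics.KineticTheory.HeatConduction.pinnedChain ω₂ lam β γ).IsChainGibbsMeasure T μ → Literature.MathematicalPhysics.KineticTheory.HeatConduction.IsShiftInvariant μ → μ.map (fun σ : Literature.MathematicalPhysics.KineticTheory.HeatConduction.ChainConfig => fun x : ℤ => ((σ x).1, -(σ x).2)) = μ → ∀ D : Literature.MathematicalPhysics.KineticTheory.HeatConduction.InfiniteChainDynamics (Literature.MathematicalPhysics.KineticTheory.HeatConduction.pinnedChain ω₂ lam β γ), D.PreservesMeasure μ → (∀ t : ℝ, ∀ᵐ σ ∂μ, D.flow t (Literature.MathematicalPhysics.KineticTheory.HeatConduction.shift σ) = Literature.MathematicalPhysics.KineticTheory.HeatConduction.shift (D.flow t σ)) → ∀ M : ℝ, 0 < M → ∀ F : ℝ → ℝ, F = (fun u : ℝ => max (-M) (min M u)) → ∀ η : ℝ, 0 < η → ∃ τ₀ : ℝ,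 ∀ τ : ℝ, τ₀ ≤ τ → ∃ L₀ : ℕ, ∀ L : ℕ, L₀ ≤ L → ∀ G : Literature.MathematicalPhysics.KineticTheory.HeatConduction.ChainConfig → ℝ, G = (fun σ : Literature.MathematicalPhysics.KineticTheory.HeatConduction.ChainConfig => ∑ x ∈ Finset.Icc (-(L : ℤ)) (L : ℤ), F ((Literature.MathematicalPhysics.KineticTheory.HeatConduction.pinnedChain ω₂ lam β γ).bondCurrentZ σ x)) → |(τ⁻¹ * ∫ t in (0:ℝ)..τ, ((∫ σ, F ((Literature.MathematicalPhysics.KineticTheory.HeatConduction.pinnedChain ω₂ lam β γ).bondCurrentZ (D.flow t σ) 0) * G σ ∂μ) - (∫ σ, F ((Literature.MathematicalPhysics.KineticTheory.HeatConduction.pinnedChain ω₂ lam β γ).bondCurrentZ (D.flow t σ) 0) ∂μ) * (∫ σ, G σ ∂μ)))| ≤ η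

theorem child1_iff : Child1 ↔ Summit.AtomisticToContinuum.FouriersLaw.Theses.BondHeatUncertainty.ExtensiveSnapshotIrreversibility := Iff.rfl
theorem child2_iff : Child2 ↔ Summit.AtomisticToContinuum.FouriersLaw.Theses.CurrentTiltQuench.DrudeFromTruncation := Iff.rfl
theorem child3_iff : Child3 ↔ Summit.AtomisticToContinuum.FouriersLaw.Theses.CurrentTiltQuench.NoTruncatedDrude := Iff.rfl

/-- the split glue, by term: the landed p150755 theorem IS `Child1 → Child2 → Child3 → NonBallistic`. -/
theorem splitGlueProbe : Child1 → Child2 → Child3 → Summit.AtomisticToContinuum.FouriersLaw.Theses.JunctionLocality.NonBallistic :=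
  Summit.AtomisticToContinuum.FouriersLaw.Theorems.NonBallistic.nonBallistic_of_extensiveSnapshotIrreversibility_of_currentTiltQuench

/-- and the twin copies of the crux (PuiseuxTransferLedger / BondHeatUncertainty share the decl text). -/
example : Child1 → Child2 → Child3 → Summit.AtomisticToContinuum.FouriersLaw.Theses.BondHeatUncertainty.NonBallistic :=
  Summit.AtomisticToContinuum.FouriersLaw.Theorems.NonBallistic.nonBallistic_of_extensiveSnapshotIrreversibility_of_currentTiltQuench

#print axioms splitGlueProbe

end Summit.AtomisticToContinuum.FouriersLaw.Theses.JunctionLocality.SplitGlueProbe
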